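import Literature.NumberTheory.LFunctions.MontgomerySmallGapsTriangleKernel
import HarnessLib

/-!
# Bui–Goldston–Milinovich–Montgomery 2023, proof of Corollary 2: the Selberg minorant `R(x) = (sin πx/πx)²/(1 − x²)` is in `𝒜(1)`, and on RH `μ_D ≤ 0.61`

Topic `Literature/NumberTheory/LFunctions` (namespace `Literature.NumberTheory.LFunctions.BGMM2023`). PROOF
LAYER (cell `landau-siegel`, §C literature harvest, seat ls-lit-typer-2 g4; OFFER-B, ls-lit-lead g3 WORDS #3
2026-08-27 "Parts (i)+(ii)"): THEOREMS ONLY — no definitions, no named facts, no new hypotheses. Source: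
H. M. Bui, D. A. Goldston, M. B. Milinovich, H. L. Montgomery, *Small gaps and small spacings between zeta
zeros*, Acta Arith. 210 (2023) 133–153 (arXiv:2208.02359), §4, proof of Corollary 2 (arXiv p. 8):

> "To make our calculations easy to verify, we will use the Selberg minorant for the characteristic function
> of the interval `[−1,1]`. … Let `R(x) = (sin πx/πx)² · 1/(1 − x²)` so that `R(0) = 1` and `R(x) ≤ 0` for
> `|x| ≥ 1`. We note that `R̂(t) = 1 − |t| + sin 2π|t|/2π` if `|t| ≤ 1`, `0` otherwise. Hence `R ∈ 𝒜(1)`.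
> For any `λ > 0`, set `r(u) = R(u/λ)` and note that `r ∈ 𝒜(λ)` with `r̂(α) = λR̂(λα)`. Thus
> `c(λ;r) = λ − 1 + 2λ ∫_0^{min(1,1/λ)} α(1 − λα + sin 2πλα/2π) dα`, and a straightforward numerical
> calculation shows that `c(0.60729;r) > 0`. Therefore, by Theorem 3, we conclude that `μ_D ≤ 0.60729`. …
> we find that `c(1.05214;r) > 0.3208` … Remark. … `c(1;r) = 1/3 − 1/2π² = 0.282673…`"

Theorem 3 (first clause) is a KERNEL THEOREM of the tree (`Literature.NumberTheory.LFunctions.buiEtAl2023_theorem3_holds`,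
engine `BGMM2023.spacingDensityPos_of_RH`, `ZetaSpacingDensityRHProofs.lean`); the class `𝒜(λ)` is
`BGMM2023.IsAdmissible` and `c(λ;r)` is `BGMM2023.cValue` (`ZetaSpacingDensityRH.lean`). This file supplies the
printed minorant and its bookkeeping, so that the positive-proportion small-spacing record PROVED in the tree under
RH moves from Montgomery's triangle (`Montgomery1973.muDLe_of_RH : RiemannHypothesis → MuDLe 0.68`,
`MontgomerySmallGapsTriangleKernel.lean`) to `0.61` (the printed root is `0.60729`; `0.61` is certified here from
three-decimal bounds on `π` and the Taylor bounds `sin θ ≤ θ`, `cos θ ≥ 1 − θ²/2`; the printed `0.6039` of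
Theorem 1/Corollary 2 needs the Chirre–Gonçalves–de Laat SDP minorant and stays the typed fact `buiEtAl2023_theorem1`).

## What is proved (Lean spellings: `R̂ t = max (1 − |t|) 0 + (if |t| ≤ 1 then sin (2π|t|)/(2π) else 0)`,
## `R x = Real.sinc (π x)²/(1 − x²)` — by Lean's `a/0 = 0` this IS the printed `R` also at `x = ±1`, where `R = 0`)

* §1 `cosTransform_sinePart` — `∫ 𝟙_{|t|≤1}(sin 2π|t|/2π) cos 2πxt dt = (1 − cos 2πx)/(2π²(1 − x²))` (FTC;
  private FTC lemmas).
* §2 `cosTransform_selbergHat` — **`(R̂)^(x) = R(x)`** for every real `x` (triangle part = the tree's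
  `Montgomery1973.cosTransform_triangle`); `selbergHat_nonneg` (**`R̂ ≥ 0`**: `sin 2π|t| ≥ −2π(1 − |t|)`),
  `selbergHat_of_one_le_abs` (support `[−1,1]`), `selbergMinorant_zero/_nonpos/_even`, `continuous_selbergMinorant`,
  `abs_selbergMinorant_le_one` (`|R| ≤ ∫R̂ = 1`), `abs_selbergMinorant_le` (`|R(x)| ≤ 3/(1 + x²)`),
  **`integrable_selbergMinorant`** (`R ∈ L¹`).
* §3 **`fourier_selbergMinorant`**: `𝓕R = R̂` (Mathlib's `Continuous.fourierInv_fourier_eq` applied to `R̂`),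
  `cosTransform_selbergMinorant`, `cosTransform_comp_div` (`(f(·/λ))^(α) = λf̂(λα)`), and
  **`isAdmissible_selbergMinorant_div`: `R(·/λ) ∈ 𝒜(λ)` for every `λ > 0`** (the second concrete member of the
  typed class after Montgomery's triangle).
* §4 `cValue_selbergMinorant_div_of_le_one` (`0 < λ ≤ 1`:
  `c(λ;r) = λ − 1 + 2λ(1/2 − λ/3 + (sin 2πλ − 2πλ cos 2πλ)/(2π(2πλ)²))`), `cValue_selbergMinorant_div_of_one_le`
  (`λ ≥ 1`: `c(λ;r) = λ − 1 + (1/3 − 1/2π²)/λ`), `cValue_selbergMinorant_one` (the Remark `c(1;r) = 1/3 − 1/2π²`).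
* §5 `cValue_selbergMinorant_pos_061` (**`c(0.61;r) > 0`**), `cValue_selbergMinorant_1_0522_gt`
  (`c(1.0522;r) > 0.32084`, the constant used in print with `n* ≤ 1.3208`; the `μ_{D_d}` assembly is not in this file).
* §6 **`spacingDensityPos_061_of_RH : RiemannHypothesis → BGMM2023.SpacingDensityPos 0.61`** — on RH, for some
  `A > 0` and all large `T`, at least `A·N(T)` indices `n < N(T)` have `γ_{n+1} − γ_n ≤ 2π·0.61/log T`;
  **`muDLe_061_of_RH : RiemannHypothesis → BGMM2023.MuDLe 0.61`**; `zetaGapLiminfLe_061_of_RH`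
  (`RiemannHypothesis → ZetaGapLiminfLe 0.61`, via the tree's `BGMM2023.MuDLe.zetaGapLiminfLe`).

Rendering notes. `𝒜(λ)` asks `r̂ ≥ 0` on the COSINE transform (`BGMM2023.cosTransform`); for the even real `R`
this is `𝓕R` (`BGMM2023.fourier_ofReal_eq_cosTransform`). "`R(x) ≤ 0` for `|x| ≥ 1`" is `selbergMinorant_nonpos`
(`≤`, with equality at `|x| = 1`). The value `0.61` replaces the printed `0.60729` (a weaker instance of the same
sentence; the margin `c(0.61;r) ≈ 2.5·10⁻³` is what three-decimal `π` bounds certify without interval arithmetic).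
No knife edge of the Landau–Siegel programme moves (`0.61 > ½`; RH is a displayed hypothesis, never asserted; the
tree's bridge `BGMM2023.subnormalGapsHypothesis_of_gapDensityPos` to Conrey–Iwaniec needs `λ < ½`). LABEL: **NOT
RH-BEARING**. «The programme SEARCHES and TYPES; no claim about Landau–Siegel zeros, Theorems 1–2 of
arXiv:2211.02515 or a repaired Margin232 until a kernel theorem says so.»

## References

* [BuiEtAl2023] H. M. Bui, D. A. Goldston, M. B. Milinovich, H. L. Montgomery, Acta Arith. 210 (2023) 133–153,
  arXiv:2208.02359: §2 (class `𝒜(λ)`, (2.1), (2.3)), Theorem 3, §4 proof of Corollary 2 (displays for `R`, `R̂`,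
  `c(λ;r)`; "`c(0.60729;r) > 0`", "`c(1.05214;r) > 0.3208`") and the Remark after it (`c(1;r) = 1/3 − 1/2π²`).
* [Montgomery1973] H. L. Montgomery, Proc. Sympos. Pure Math. 24 (1973) 181–193, §4 (the triangle kernel) — tree:
  `MontgomerySmallGapsTriangleKernel.lean`.
* Tree: `ZetaSpacingDensityRH.lean` (vocabulary), `ZetaSpacingDensityRHProofs.lean` (Theorem 3 and the Fourier
  bookkeeping `fourier_ofReal_eq_cosTransform`, `continuous_cosTransform`, `abs_cosTransform_le`),
  `AlternativeHypothesisFormFactorProofs.lean` (`AH.fourier_fejerTest`), Mathlib `Mathlib.Analysis.Fourier.Inversion`.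
-/

noncomputable section

open Filter Set MeasureTheory Real Finset
open scoped Topology FourierTransform

namespace Literature.NumberTheory.LFunctions

namespace BGMM2023

/-! ## §0. Two pieces of bookkeeping -/

/-- `∫_{−1}^{1} f = 2∫_0^1 f` for an even `f`. [folklore] -/
private theorem intervalIntegral_symm_of_even {f : ℝ → ℝ} (hf : ∀ t, f (-t) = f t)
    (h1 : IntervalIntegrable f volume (-1) 0) (h2 : IntervalIntegrable f volume 0 1) :
    ∫ t in (-1 : ℝ)..1, f t = 2 * ∫ t in (0 : ℝ)..1, f t := by
  rw [← intervalIntegral.integral_add_adjacent_intervals h1 h2]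
  have h : ∫ t in (-1 : ℝ)..0, f t = ∫ t in (0 : ℝ)..1, f t := by
    have h' := intervalIntegral.integral_comp_neg f (a := (0 : ℝ)) (b := 1)
    rw [neg_zero] at h'
    rw [← h']
    exact intervalIntegral.integral_congr fun t _ ↦ hf t
  rw [h]; ring

/-- `(f + g)^ = f̂ + ĝ` for integrable `f, g`. [cite: BuiEtAl2023, §2 (2.1)] -/
theorem cosTransform_add {f g : ℝ → ℝ} (hf : Integrable f) (hg : Integrable g) (α : ℝ) :
    cosTransform (fun u ↦ f u + g u) α = cosTransform f α + cosTransform g α := by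
  unfold cosTransform
  rw [← integral_add (integrable_mul_cos hf α) (integrable_mul_cos hg α)]
  exact integral_congr_ae (Eventually.of_forall fun u ↦ by simp only; ring)

/-! ## §1. The sine part `W(t) = 𝟙_{|t| ≤ 1} sin(2π|t|)/2π` of `R̂` and its cosine transform -/

/-- `∫_0^1 sin(2πt) cos(at) dt = 2π(1 − cos a)/(4π² − a²)` for `a ≠ ±2π`. [folklore] -/
private theorem integral_sin_two_pi_mul_cos {a : ℝ} (h1 : 2 * π + a ≠ 0) (h2 : 2 * π - a ≠ 0) :
    ∫ t in (0 : ℝ)..1, Real.sin (2 * π * t) * Real.cos (a * t) =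
      2 * π * (1 - Real.cos a) / (4 * π ^ 2 - a ^ 2) := by
  set F : ℝ → ℝ := fun t ↦
    -(Real.cos ((2 * π + a) * t) / (2 * π + a) + Real.cos ((2 * π - a) * t) / (2 * π - a)) / 2
  have hderiv : ∀ t ∈ Set.uIcc (0 : ℝ) 1,
      HasDerivAt F (Real.sin (2 * π * t) * Real.cos (a * t)) t := by
    intro t _
    have hA : HasDerivAt (fun t : ℝ ↦ Real.cos ((2 * π + a) * t))
        (-Real.sin ((2 * π + a) * t) * (2 * π + a)) t := by
      have h := (hasDerivAt_id t).const_mul (2 * π + a)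
      rw [mul_one] at h
      exact h.cos
    have hB : HasDerivAt (fun t : ℝ ↦ Real.cos ((2 * π - a) * t))
        (-Real.sin ((2 * π - a) * t) * (2 * π - a)) t := by
      have h := (hasDerivAt_id t).const_mul (2 * π - a)
      rw [mul_one] at h
      exact h.cos
    have h := ((hA.div_const (2 * π + a)).fun_add (hB.div_const (2 * π - a))).fun_neg.div_const 2
    refine h.congr_deriv ?_
    have e1 : Real.sin ((2 * π + a) * t) = Real.sin (2 * π * t) * Real.cos (a * t) +
        Real.cos (2 * π * t) * Real.sin (a * t) := by
      rw [show (2 * π + a) * t = 2 * π * t + a * t by ring, Real.sin_add]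
    have e2 : Real.sin ((2 * π - a) * t) = Real.sin (2 * π * t) * Real.cos (a * t) -
        Real.cos (2 * π * t) * Real.sin (a * t) := by
      rw [show (2 * π - a) * t = 2 * π * t - a * t by ring, Real.sin_sub]
    rw [e1, e2]
    field_simp
    ring
  have hint : IntervalIntegrable (fun t : ℝ ↦ Real.sin (2 * π * t) * Real.cos (a * t)) volume 0 1 :=
    (by fun_prop : Continuous fun t : ℝ ↦ Real.sin (2 * π * t) * Real.cos (a * t)).intervalIntegrable _ _
  rw [intervalIntegral.integral_eq_sub_of_hasDerivAt hderiv hint]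
  simp only [F, mul_one, mul_zero, Real.cos_zero]
  have c1 : Real.cos (2 * π + a) = Real.cos a := by
    rw [show 2 * π + a = a + 2 * π by ring, Real.cos_add_two_pi]
  have c2 : Real.cos (2 * π - a) = Real.cos a := by
    rw [show 2 * π - a = -(a - 2 * π) by ring, Real.cos_neg, Real.cos_sub_two_pi]
  rw [c1, c2]
  have h3 : 4 * π ^ 2 - a ^ 2 = (2 * π + a) * (2 * π - a) := by ring
  rw [h3]
  field_simp
  ring

/-- `∫_0^1 sin(2πt) cos(2πt) dt = 0`. [folklore] -/
private theorem integral_sin_two_pi_mul_cos_two_pi :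
    ∫ t in (0 : ℝ)..1, Real.sin (2 * π * t) * Real.cos (2 * π * t) = 0 := by
  set F : ℝ → ℝ := fun t ↦ -Real.cos (4 * π * t) / (8 * π)
  have hderiv : ∀ t ∈ Set.uIcc (0 : ℝ) 1,
      HasDerivAt F (Real.sin (2 * π * t) * Real.cos (2 * π * t)) t := by
    intro t _
    have hA : HasDerivAt (fun t : ℝ ↦ Real.cos (4 * π * t)) (-Real.sin (4 * π * t) * (4 * π)) t := by
      have h := (hasDerivAt_id t).const_mul (4 * π)
      rw [mul_one] at h
      exact h.cos
    have h := hA.fun_neg.div_const (8 * π)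
    refine h.congr_deriv ?_
    have e : Real.sin (4 * π * t) = 2 * Real.sin (2 * π * t) * Real.cos (2 * π * t) := by
      rw [show 4 * π * t = 2 * (2 * π * t) by ring, Real.sin_two_mul]
    rw [e]
    field_simp
    ring
  have hint : IntervalIntegrable (fun t : ℝ ↦ Real.sin (2 * π * t) * Real.cos (2 * π * t)) volume 0 1 :=
    (by fun_prop : Continuous fun t : ℝ ↦ Real.sin (2 * π * t) * Real.cos (2 * π * t)).intervalIntegrable _ _
  rw [intervalIntegral.integral_eq_sub_of_hasDerivAt hderiv hint]
  simp only [F, mul_one, mul_zero, Real.cos_zero]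
  have c1 : Real.cos (4 * π) = 1 := by
    rw [show (4 : ℝ) * π = (2 : ℕ) * (2 * π) by push_cast; ring, Real.cos_nat_mul_two_pi]
  rw [c1]
  ring

/-- The sine part is continuous (`sin 2π = 0` at the break points). [cite: BuiEtAl2023, §4 (proof of Corollary 2)] -/
theorem continuous_sinePart :
    Continuous fun t : ℝ ↦ if |t| ≤ 1 then Real.sin (2 * π * |t|) / (2 * π) else 0 := by
  refine Continuous.if_le (by fun_prop) continuous_const (by fun_prop) continuous_const fun t ht ↦ ?_
  rw [ht, mul_one, Real.sin_two_pi, zero_div]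

/-- The sine part vanishes off `[−1, 1]`. [cite: BuiEtAl2023, §4 (proof of Corollary 2)] -/
theorem sinePart_eq_zero {t : ℝ} (ht : 1 < |t|) :
    (if |t| ≤ 1 then Real.sin (2 * π * |t|) / (2 * π) else 0) = 0 :=
  if_neg (not_le.2 ht)

/-- The sine part is integrable (continuous, compact support). [cite: BuiEtAl2023, §4 (proof of Corollary 2)] -/
theorem integrable_sinePart :
    Integrable fun t : ℝ ↦ if |t| ≤ 1 then Real.sin (2 * π * |t|) / (2 * π) else 0 := by
  refine continuous_sinePart.integrable_of_hasCompactSupport ?_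
  refine HasCompactSupport.intro (isCompact_Icc (a := (-1 : ℝ)) (b := 1)) fun t ht ↦ ?_
  rw [Set.mem_Icc, ← abs_le] at ht
  exact sinePart_eq_zero (not_le.1 ht)

/-- The sine part is even. [cite: BuiEtAl2023, §4 (proof of Corollary 2)] -/
theorem sinePart_even (t : ℝ) :
    (if |(-t)| ≤ 1 then Real.sin (2 * π * |(-t)|) / (2 * π) else 0) =
      if |t| ≤ 1 then Real.sin (2 * π * |t|) / (2 * π) else 0 := by
  rw [abs_neg]

/-- **Fold to `[0, 1]`**: `Ŵ(x) = 2∫_0^1 (sin 2πt/2π) cos(2πxt) dt`. [cite: BuiEtAl2023, §4 (proof of Corollary 2)] -/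
theorem cosTransform_sinePart_eq_intervalIntegral (x : ℝ) :
    cosTransform (fun t : ℝ ↦ if |t| ≤ 1 then Real.sin (2 * π * |t|) / (2 * π) else 0) x =
      2 * ∫ t in (0 : ℝ)..1, Real.sin (2 * π * t) / (2 * π) * Real.cos (2 * π * x * t) := by
  unfold cosTransform
  have hzero : ∀ t, t ∉ Set.Icc (-1 : ℝ) 1 →
      (if |t| ≤ 1 then Real.sin (2 * π * |t|) / (2 * π) else 0) * Real.cos (2 * π * x * t) = 0 := by
    intro t ht
    rw [Set.mem_Icc, ← abs_le] at ht
    rw [if_neg ht, zero_mul]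
  rw [← setIntegral_eq_integral_of_forall_compl_eq_zero hzero, integral_Icc_eq_integral_Ioc,
    ← intervalIntegral.integral_of_le (by norm_num : (-1 : ℝ) ≤ 1)]
  have heven : ∀ t : ℝ, (if |(-t)| ≤ 1 then Real.sin (2 * π * |(-t)|) / (2 * π) else 0) *
      Real.cos (2 * π * x * -t) =
      (if |t| ≤ 1 then Real.sin (2 * π * |t|) / (2 * π) else 0) * Real.cos (2 * π * x * t) := by
    intro t
    rw [abs_neg, mul_neg, Real.cos_neg]
  have hc : Continuous fun t : ℝ ↦
      (if |t| ≤ 1 then Real.sin (2 * π * |t|) / (2 * π) else 0) * Real.cos (2 * π * x * t) :=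
    continuous_sinePart.mul (by fun_prop)
  rw [intervalIntegral_symm_of_even heven (hc.intervalIntegrable _ _) (hc.intervalIntegrable _ _)]
  congr 1
  refine intervalIntegral.integral_congr fun t ht ↦ ?_
  rw [Set.uIcc_of_le zero_le_one, Set.mem_Icc] at ht
  rw [if_pos (by rw [abs_le]; constructor <;> linarith), abs_of_nonneg ht.1]

/-- **`Ŵ(x) = (1 − cos 2πx)/(2π²(1 − x²))`** for every real `x` (at `x = ±1` both sides vanish —
Lean's `a/0 = 0` matches the value `∫_0^1 sin 2πt cos 2πt dt/π = 0`). [cite: BuiEtAl2023, §4 (proof of Corollary 2)] -/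
theorem cosTransform_sinePart (x : ℝ) :
    cosTransform (fun t : ℝ ↦ if |t| ≤ 1 then Real.sin (2 * π * |t|) / (2 * π) else 0) x =
      (1 - Real.cos (2 * π * x)) / (2 * π ^ 2 * (1 - x ^ 2)) := by
  -- reduce to `x ≥ 0`-free form: the integral only sees `cos(2πxt)`
  rw [cosTransform_sinePart_eq_intervalIntegral]
  have hsplit : (∫ t in (0 : ℝ)..1, Real.sin (2 * π * t) / (2 * π) * Real.cos (2 * π * x * t)) =
      (1 / (2 * π)) * ∫ t in (0 : ℝ)..1, Real.sin (2 * π * t) * Real.cos (2 * π * x * t) := by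
    rw [← intervalIntegral.integral_const_mul]
    refine intervalIntegral.integral_congr fun t _ ↦ ?_
    ring
  rw [hsplit]
  by_cases hx : x ^ 2 = 1
  · -- `x = ±1`: both sides are `0`
    have hx' : x = 1 ∨ x = -1 := sq_eq_one_iff.mp hx
    have h0 : ∫ t in (0 : ℝ)..1, Real.sin (2 * π * t) * Real.cos (2 * π * x * t) = 0 := by
      rcases hx' with rfl | rfl
      · rw [mul_one]; exact integral_sin_two_pi_mul_cos_two_pi
      · have : (fun t : ℝ ↦ Real.sin (2 * π * t) * Real.cos (2 * π * -1 * t)) =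
            fun t ↦ Real.sin (2 * π * t) * Real.cos (2 * π * t) := by
          funext t; rw [show 2 * π * -1 * t = -(2 * π * t) by ring, Real.cos_neg]
        rw [this]; exact integral_sin_two_pi_mul_cos_two_pi
    rw [h0, hx]; simp
  · have h1 : 2 * π + 2 * π * x ≠ 0 := by
      rw [show 2 * π + 2 * π * x = 2 * π * (1 + x) by ring]
      refine mul_ne_zero (by positivity) fun h ↦ hx ?_
      have : x = -1 := by linarith
      rw [this]; norm_num
    have h2 : 2 * π - 2 * π * x ≠ 0 := by
      rw [show 2 * π - 2 * π * x = 2 * π * (1 - x) by ring]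
      refine mul_ne_zero (by positivity) fun h ↦ hx ?_
      have : x = 1 := by linarith
      rw [this]; norm_num
    rw [integral_sin_two_pi_mul_cos h1 h2]
    have h3 : (1 : ℝ) - x ^ 2 ≠ 0 := sub_ne_zero.2 (Ne.symm hx)
    have hπ : (π : ℝ) ≠ 0 := Real.pi_ne_zero
    have h4 : 4 * π ^ 2 - (2 * π * x) ^ 2 = 4 * π ^ 2 * (1 - x ^ 2) := by ring
    rw [h4]
    field_simp
    ring


/-! ## §2. `R̂ = Δ + W` (triangle plus sine part) and the closed form `R(x) = (sin πx/πx)²/(1 − x²)` -/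

/-- Montgomery's unit triangle in the tree's spelling. [cite: BuiEtAl2023, §4 (proof of Corollary 2)] -/
theorem triangle_one_eq : (fun u : ℝ ↦ max (1 - |u|) 0) = fun u ↦ max (1 - |u| / 1) 0 := by
  funext u; rw [div_one]

/-- `R̂` is continuous. [cite: BuiEtAl2023, §4 (proof of Corollary 2)] -/
theorem continuous_selbergHat : Continuous fun t : ℝ ↦
    max (1 - |t|) 0 + (if |t| ≤ 1 then Real.sin (2 * π * |t|) / (2 * π) else 0) := by
  have h1 : Continuous fun u : ℝ ↦ max (1 - |u|) 0 := by
    rw [triangle_one_eq]; exact Montgomery1973.continuous_triangle one_pos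
  exact h1.add continuous_sinePart

/-- `R̂ ∈ L¹`. [cite: BuiEtAl2023, §4 (proof of Corollary 2)] -/
theorem integrable_selbergHat : Integrable fun t : ℝ ↦
    max (1 - |t|) 0 + (if |t| ≤ 1 then Real.sin (2 * π * |t|) / (2 * π) else 0) := by
  have h1 : Integrable fun u : ℝ ↦ max (1 - |u|) 0 := by
    rw [triangle_one_eq]; exact Montgomery1973.integrable_triangle one_pos
  exact h1.add integrable_sinePart

/-- `R̂` is even. [cite: BuiEtAl2023, §4 (proof of Corollary 2)] -/
theorem selbergHat_even (t : ℝ) :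
    max (1 - |(-t)|) 0 + (if |(-t)| ≤ 1 then Real.sin (2 * π * |(-t)|) / (2 * π) else 0) =
      max (1 - |t|) 0 + (if |t| ≤ 1 then Real.sin (2 * π * |t|) / (2 * π) else 0) := by
  rw [abs_neg]

/-- `R̂(t) = 1 − |t| + sin(2π|t|)/2π` on `|t| ≤ 1`. [cite: BuiEtAl2023, §4 (proof of Corollary 2)] -/
theorem selbergHat_of_abs_le_one {t : ℝ} (ht : |t| ≤ 1) :
    max (1 - |t|) 0 + (if |t| ≤ 1 then Real.sin (2 * π * |t|) / (2 * π) else 0) =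
      1 - |t| + Real.sin (2 * π * |t|) / (2 * π) := by
  rw [max_eq_left (by linarith), if_pos ht]

/-- `R̂(t) = 0` for `|t| ≥ 1` ("0, otherwise"; at `|t| = 1` the value is `sin 2π/2π = 0`).
[cite: BuiEtAl2023, §4 (proof of Corollary 2)] -/
theorem selbergHat_of_one_le_abs {t : ℝ} (ht : 1 ≤ |t|) :
    max (1 - |t|) 0 + (if |t| ≤ 1 then Real.sin (2 * π * |t|) / (2 * π) else 0) = 0 := by
  rw [max_eq_right (by linarith), zero_add]
  split_ifs with h
  · rw [le_antisymm h ht, mul_one, Real.sin_two_pi, zero_div]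
  · rfl

/-- `R̂(0) = 1`. [cite: BuiEtAl2023, §4 (proof of Corollary 2)] -/
theorem selbergHat_zero :
    max (1 - |(0 : ℝ)|) 0 + (if |(0 : ℝ)| ≤ 1 then Real.sin (2 * π * |(0 : ℝ)|) / (2 * π) else 0) = 1 := by
  simp

/-- **`R̂ ≥ 0`**: on `|t| ≤ 1`, `sin 2π|t| = −sin 2π(1 − |t|) ≥ −2π(1 − |t|)`.
[cite: BuiEtAl2023, §4 (proof of Corollary 2, "R ∈ 𝒜(1)")] -/
theorem selbergHat_nonneg (t : ℝ) :
    0 ≤ max (1 - |t|) 0 + (if |t| ≤ 1 then Real.sin (2 * π * |t|) / (2 * π) else 0) := by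
  rcases le_or_gt (|t|) 1 with h | h
  · rw [selbergHat_of_abs_le_one h]
    have h1 : Real.sin (2 * π * (1 - |t|)) ≤ 2 * π * (1 - |t|) :=
      Real.sin_le (by nlinarith [Real.pi_pos])
    have h2 : Real.sin (2 * π * |t|) = -Real.sin (2 * π * (1 - |t|)) := by
      rw [show 2 * π * |t| = 2 * π - 2 * π * (1 - |t|) by ring, Real.sin_two_pi_sub]
    rw [h2, neg_div, ← sub_eq_add_neg, sub_nonneg, div_le_iff₀ (by positivity)]
    linarith
  · rw [selbergHat_of_one_le_abs h.le]

/-- **The closed form `R(x) = (sin πx/πx)²·1/(1 − x²)` of the cosine transform of `R̂ = Δ + W`**, for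
EVERY real `x` (Lean's `a/0 = 0` gives the correct value `0` at `x = ±1`): `Δ̂(x) = sinc(πx)²` (the tree's
`Montgomery1973.cosTransform_triangle`) plus `Ŵ(x) = (1 − cos 2πx)/(2π²(1 − x²)) = sin²πx/(π²(1 − x²))`.
[cite: BuiEtAl2023, §4 (proof of Corollary 2, display (R))] -/
theorem cosTransform_selbergHat (x : ℝ) :
    cosTransform (fun t : ℝ ↦
        max (1 - |t|) 0 + (if |t| ≤ 1 then Real.sin (2 * π * |t|) / (2 * π) else 0)) x =
      Real.sinc (π * x) ^ 2 / (1 - x ^ 2) := by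
  have hT : Integrable fun u : ℝ ↦ max (1 - |u|) 0 := by
    rw [triangle_one_eq]; exact Montgomery1973.integrable_triangle one_pos
  rw [cosTransform_add hT integrable_sinePart, cosTransform_sinePart, triangle_one_eq,
    Montgomery1973.cosTransform_triangle one_pos, one_mul, mul_one]
  -- `sinc(πx)² + (1 − cos 2πx)/(2π²(1 − x²)) = sinc(πx)²/(1 − x²)`
  by_cases hx0 : x = 0
  · subst hx0; simp
  by_cases hx1 : x ^ 2 = 1
  · have hs : Real.sinc (π * x) = 0 := by
      rcases sq_eq_one_iff.mp hx1 with rfl | rfl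
      · rw [mul_one, Real.sinc_of_ne_zero Real.pi_ne_zero, Real.sin_pi, zero_div]
      · rw [mul_neg, mul_one, Real.sinc_neg, Real.sinc_of_ne_zero Real.pi_ne_zero, Real.sin_pi,
          zero_div]
    rw [hs, hx1]; simp
  have hπx : π * x ≠ 0 := mul_ne_zero Real.pi_ne_zero hx0
  have h1x : (1 : ℝ) - x ^ 2 ≠ 0 := sub_ne_zero.2 (Ne.symm hx1)
  rw [Real.sinc_of_ne_zero hπx]
  have hc : Real.cos (2 * π * x) = 2 * Real.cos (π * x) ^ 2 - 1 := by
    rw [show 2 * π * x = 2 * (π * x) by ring, Real.cos_two_mul]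
  have hs : Real.sin (π * x) ^ 2 = 1 - Real.cos (π * x) ^ 2 := Real.sin_sq _
  rw [hc, div_pow]
  field_simp
  rw [hs]
  ring

/-- `R` is even. [cite: BuiEtAl2023, §4 (proof of Corollary 2)] -/
theorem selbergMinorant_even (u : ℝ) :
    Real.sinc (π * -u) ^ 2 / (1 - (-u) ^ 2) = Real.sinc (π * u) ^ 2 / (1 - u ^ 2) := by
  rw [mul_neg, Real.sinc_neg, neg_sq]

/-- `R(0) = 1`. [cite: BuiEtAl2023, §4 (proof of Corollary 2, "R(0) = 1")] -/
theorem selbergMinorant_zero : Real.sinc (π * (0 : ℝ)) ^ 2 / (1 - (0 : ℝ) ^ 2) = 1 := by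
  simp

/-- `R(x) ≤ 0` for `|x| ≥ 1` (it vanishes at `|x| = 1`). [cite: BuiEtAl2023, §4 (proof of Corollary 2, "R(x) ≤ 0 for |x| ≥ 1")] -/
theorem selbergMinorant_nonpos {u : ℝ} (hu : 1 ≤ |u|) : Real.sinc (π * u) ^ 2 / (1 - u ^ 2) ≤ 0 := by
  refine div_nonpos_iff.2 (Or.inl ⟨sq_nonneg _, ?_⟩)
  have : 1 ≤ u ^ 2 := by rw [← sq_abs]; nlinarith
  linarith

/-- `R = (R̂)^`, as functions. [cite: BuiEtAl2023, §4 (proof of Corollary 2)] -/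
theorem selbergMinorant_eq_cosTransform :
    (fun x : ℝ ↦ Real.sinc (π * x) ^ 2 / (1 - x ^ 2)) = cosTransform (fun t : ℝ ↦
        max (1 - |t|) 0 + (if |t| ≤ 1 then Real.sin (2 * π * |t|) / (2 * π) else 0)) :=
  funext fun x ↦ (cosTransform_selbergHat x).symm

/-- `R` is continuous (as the Fourier transform of an `L¹` function). [cite: BuiEtAl2023, §4 (proof of Corollary 2)] -/
theorem continuous_selbergMinorant : Continuous fun x : ℝ ↦ Real.sinc (π * x) ^ 2 / (1 - x ^ 2) := by
  rw [selbergMinorant_eq_cosTransform]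
  exact continuous_cosTransform selbergHat_even integrable_selbergHat

/-- `|R(x)| ≤ ∫ R̂ = R(0) = 1`. [cite: BuiEtAl2023, §4 (proof of Corollary 2)] -/
theorem abs_selbergMinorant_le_one (x : ℝ) : |Real.sinc (π * x) ^ 2 / (1 - x ^ 2)| ≤ 1 := by
  rw [← cosTransform_selbergHat]
  refine (abs_cosTransform_le integrable_selbergHat x).trans (le_of_eq ?_)
  have h1 : (∫ u : ℝ, |max (1 - |u|) 0 + (if |u| ≤ 1 then Real.sin (2 * π * |u|) / (2 * π) else 0)|) =
      cosTransform (fun t : ℝ ↦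
        max (1 - |t|) 0 + (if |t| ≤ 1 then Real.sin (2 * π * |t|) / (2 * π) else 0)) 0 := by
    unfold cosTransform
    refine integral_congr_ae (Eventually.of_forall fun u ↦ ?_)
    simp only [mul_zero, zero_mul, Real.cos_zero, mul_one]
    exact abs_of_nonneg (selbergHat_nonneg u)
  rw [h1, cosTransform_selbergHat, selbergMinorant_zero]

/-- Tail bound: `|R(x)| ≤ 3/(1 + x²)` for every `x` (`≤ 1` on `x² ≤ 2`; `≤ sinc(πx)² ≤ 1/(π²x²)` beyond).
[cite: BuiEtAl2023, §4 (proof of Corollary 2)] -/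
theorem abs_selbergMinorant_le (x : ℝ) :
    |Real.sinc (π * x) ^ 2 / (1 - x ^ 2)| ≤ 3 * (1 + x ^ 2)⁻¹ := by
  rcases le_or_gt (x ^ 2) 2 with h | h
  · refine (abs_selbergMinorant_le_one x).trans ?_
    rw [← div_eq_mul_inv, le_div_iff₀ (by positivity)]
    linarith
  · have hx0 : x ≠ 0 := by rintro rfl; norm_num at h
    have hπx : π * x ≠ 0 := mul_ne_zero Real.pi_ne_zero hx0
    have hs : |Real.sinc (π * x)| ≤ 1 / |π * x| := by
      rw [Real.sinc_of_ne_zero hπx, abs_div]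
      exact div_le_div_of_nonneg_right (Real.abs_sin_le_one _) (abs_nonneg _)
    have hs2 : Real.sinc (π * x) ^ 2 ≤ 1 / (π ^ 2 * x ^ 2) := by
      rw [← sq_abs, show 1 / (π ^ 2 * x ^ 2) = (1 / |π * x|) ^ 2 by
        rw [div_pow, one_pow, sq_abs, mul_pow]]
      exact pow_le_pow_left₀ (abs_nonneg _) hs 2
    have hx2 : 0 < x ^ 2 := by positivity
    have hπ2 : 1 ≤ π ^ 2 := by nlinarith [Real.pi_gt_three]
    rw [abs_div, abs_of_nonneg (sq_nonneg _), abs_of_neg (by linarith : 1 - x ^ 2 < 0)]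
    calc Real.sinc (π * x) ^ 2 / -(1 - x ^ 2) ≤ Real.sinc (π * x) ^ 2 / 1 :=
          div_le_div_of_nonneg_left (sq_nonneg _) one_pos (by linarith)
      _ ≤ 1 / (π ^ 2 * x ^ 2) := by rw [div_one]; exact hs2
      _ ≤ 1 / x ^ 2 := div_le_div_of_nonneg_left zero_le_one hx2 (by nlinarith)
      _ ≤ 3 * (1 + x ^ 2)⁻¹ := by
          rw [← div_eq_mul_inv, div_le_div_iff₀ hx2 (by positivity)]
          nlinarith

/-- **`R ∈ L¹`**. [cite: BuiEtAl2023, §4 (proof of Corollary 2, "R ∈ 𝒜(1)")] -/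
theorem integrable_selbergMinorant : Integrable fun x : ℝ ↦ Real.sinc (π * x) ^ 2 / (1 - x ^ 2) := by
  refine (integrable_inv_one_add_sq.const_mul 3).mono' continuous_selbergMinorant.aestronglyMeasurable
    (Eventually.of_forall fun x ↦ ?_)
  rw [Real.norm_eq_abs]
  exact abs_selbergMinorant_le x


/-! ## §3. Fourier inversion: `R̂` IS the transform of `R`; the dilates `R(·/λ)` are in `𝒜(λ)` -/

/-- **`𝓕R = R̂`** (Fourier inversion: `R = 𝓕R̂` with `R̂` continuous, even, `R̂, R ∈ L¹`).
[cite: BuiEtAl2023, §4 (proof of Corollary 2, display (R̂))] -/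
theorem fourier_selbergMinorant (x : ℝ) :
    𝓕 (fun u : ℝ ↦ ((Real.sinc (π * u) ^ 2 / (1 - u ^ 2) : ℝ) : ℂ)) x =
      ((max (1 - |x|) 0 + (if |x| ≤ 1 then Real.sin (2 * π * |x|) / (2 * π) else 0) : ℝ) : ℂ) := by
  set S : ℝ → ℝ := fun t ↦
    max (1 - |t|) 0 + (if |t| ≤ 1 then Real.sin (2 * π * |t|) / (2 * π) else 0) with hSdef
  set f : ℝ → ℂ := fun u ↦ (S u : ℂ) with hfdef
  have hf : Integrable f := integrable_selbergHat.ofReal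
  have hfc : Continuous f := Complex.continuous_ofReal.comp continuous_selbergHat
  have hF : 𝓕 f = fun ξ ↦ ((Real.sinc (π * ξ) ^ 2 / (1 - ξ ^ 2) : ℝ) : ℂ) := by
    funext ξ
    rw [hfdef, fourier_ofReal_eq_cosTransform selbergHat_even integrable_selbergHat ξ,
      cosTransform_selbergHat]
  have hFi : Integrable (𝓕 f) := by
    rw [hF]; exact integrable_selbergMinorant.ofReal
  have hinv := hfc.fourierInv_fourier_eq hf hFi
  rw [hF] at hinv
  have h1 : 𝓕⁻ (fun ξ : ℝ ↦ ((Real.sinc (π * ξ) ^ 2 / (1 - ξ ^ 2) : ℝ) : ℂ)) (-x) = f (-x) := by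
    rw [hinv]
  rw [Real.fourierInv_eq_fourier_neg, neg_neg] at h1
  rw [h1, hfdef]
  dsimp only
  rw [hSdef]
  dsimp only
  rw [abs_neg]

/-- **`(R)^ = R̂`** on the cosine-transform side: `∫ R(u) cos 2παu du = R̂(α)`.
[cite: BuiEtAl2023, §4 (proof of Corollary 2, display (R̂))] -/
theorem cosTransform_selbergMinorant (α : ℝ) :
    cosTransform (fun u : ℝ ↦ Real.sinc (π * u) ^ 2 / (1 - u ^ 2)) α =
      max (1 - |α|) 0 + (if |α| ≤ 1 then Real.sin (2 * π * |α|) / (2 * π) else 0) := by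
  have h := fourier_ofReal_eq_cosTransform selbergMinorant_even integrable_selbergMinorant α
  rw [fourier_selbergMinorant] at h
  exact_mod_cast h.symm

/-- Dilation: `(f(·/λ))^(α) = λ f̂(λα)` for `λ > 0`. [cite: BuiEtAl2023, §4 (proof of Corollary 2, "r̂(α) = λR̂(λα)")] -/
theorem cosTransform_comp_div (f : ℝ → ℝ) {lam : ℝ} (hlam : 0 < lam) (α : ℝ) :
    cosTransform (fun u ↦ f (u / lam)) α = lam * cosTransform f (lam * α) := by
  unfold cosTransform
  have h : (fun u : ℝ ↦ f (u / lam) * Real.cos (2 * π * α * u)) =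
      fun u ↦ (fun y ↦ f y * Real.cos (2 * π * (lam * α) * y)) (u / lam) := by
    funext u
    simp only
    rw [show 2 * π * (lam * α) * (u / lam) = 2 * π * α * u by field_simp]
  rw [h]
  have h2 := Measure.integral_comp_div (fun y ↦ f y * Real.cos (2 * π * (lam * α) * y)) lam
  rw [abs_of_pos hlam, smul_eq_mul] at h2
  exact h2

/-- **`r = R(·/λ) ∈ 𝒜(λ)`** for every `λ > 0`: even, continuous, `L¹`, `r(0) = 1`, `r(u) ≤ 0` for
`|u| > λ`, and `r̂(α) = λR̂(λα) ≥ 0`. [cite: BuiEtAl2023, §4 (proof of Corollary 2, "r ∈ 𝒜(λ)")] -/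
theorem isAdmissible_selbergMinorant_div {lam : ℝ} (hlam : 0 < lam) :
    IsAdmissible (fun u : ℝ ↦ Real.sinc (π * (u / lam)) ^ 2 / (1 - (u / lam) ^ 2)) lam where
  even u := by rw [neg_div]; exact selbergMinorant_even _
  continuous := continuous_selbergMinorant.comp (continuous_id.div_const lam)
  integrable := integrable_selbergMinorant.comp_div hlam.ne'
  map_zero := by simp
  nonpos u hu := by
    refine selbergMinorant_nonpos ?_
    rw [abs_div, abs_of_pos hlam, le_div_iff₀ hlam, one_mul]
    exact hu.le
  transform_nonneg α := by
    rw [cosTransform_comp_div (fun y : ℝ ↦ Real.sinc (π * y) ^ 2 / (1 - y ^ 2)) hlam,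
      cosTransform_selbergMinorant]
    exact mul_nonneg hlam.le (selbergHat_nonneg _)

/-- `r̂(α) = λR̂(λα)` for `r = R(·/λ)`. [cite: BuiEtAl2023, §4 (proof of Corollary 2)] -/
theorem cosTransform_selbergMinorant_div {lam : ℝ} (hlam : 0 < lam) (α : ℝ) :
    cosTransform (fun u : ℝ ↦ Real.sinc (π * (u / lam)) ^ 2 / (1 - (u / lam) ^ 2)) α =
      lam * (max (1 - |lam * α|) 0 +
        (if |lam * α| ≤ 1 then Real.sin (2 * π * |lam * α|) / (2 * π) else 0)) := by
  rw [cosTransform_comp_div (fun y : ℝ ↦ Real.sinc (π * y) ^ 2 / (1 - y ^ 2)) hlam,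
    cosTransform_selbergMinorant]

/-! ## §4. The criterion constant `c(λ;r) = λ − 1 + 2λ∫_0^{min(1,1/λ)} α(1 − λα + sin 2πλα/2π) dα` -/

/-- `∫_0^1 α R̂(λα) dα = 1/2 − λ/3 + (sin 2πλ − 2πλ cos 2πλ)/(2π(2πλ)²)` for `0 < λ ≤ 1`.
[cite: BuiEtAl2023, §4 (proof of Corollary 2, display for c(λ;r))] -/
theorem integral_mul_selbergHat_of_le_one {lam : ℝ} (h0 : 0 < lam) (h1 : lam ≤ 1) :
    ∫ α in (0 : ℝ)..1, α * (max (1 - |lam * α|) 0 +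
        (if |lam * α| ≤ 1 then Real.sin (2 * π * |lam * α|) / (2 * π) else 0)) =
      1 / 2 - lam / 3 + (Real.sin (2 * π * lam) - 2 * π * lam * Real.cos (2 * π * lam)) /
        (2 * π * (2 * π * lam) ^ 2) := by
  set c : ℝ := 2 * π * lam with hc
  have hc0 : c ≠ 0 := by positivity
  have hcongr : ∫ α in (0 : ℝ)..1, α * (max (1 - |lam * α|) 0 +
        (if |lam * α| ≤ 1 then Real.sin (2 * π * |lam * α|) / (2 * π) else 0)) =
      ∫ α in (0 : ℝ)..1, (α - lam * α ^ 2 + α * Real.sin (c * α) / (2 * π)) := by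
    refine intervalIntegral.integral_congr fun α hα ↦ ?_
    rw [Set.uIcc_of_le zero_le_one, Set.mem_Icc] at hα
    have hla : 0 ≤ lam * α := mul_nonneg h0.le hα.1
    have hla1 : lam * α ≤ 1 := by nlinarith
    rw [selbergHat_of_abs_le_one (by rw [abs_of_nonneg hla]; exact hla1), abs_of_nonneg hla, hc]
    ring_nf
  rw [hcongr]
  set F : ℝ → ℝ := fun α ↦ α ^ 2 / 2 - lam * α ^ 3 / 3 +
    (Real.sin (c * α) - c * α * Real.cos (c * α)) / (2 * π * c ^ 2)
  have hderiv : ∀ α ∈ Set.uIcc (0 : ℝ) 1,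
      HasDerivAt F (α - lam * α ^ 2 + α * Real.sin (c * α) / (2 * π)) α := by
    intro α _
    have hl : HasDerivAt (fun α : ℝ ↦ c * α) c α := by
      simpa using (hasDerivAt_id α).const_mul c
    have hS : HasDerivAt (fun α : ℝ ↦ Real.sin (c * α)) (Real.cos (c * α) * c) α := hl.sin
    have hC : HasDerivAt (fun α : ℝ ↦ Real.cos (c * α)) (-Real.sin (c * α) * c) α := hl.cos
    have hP : HasDerivAt (fun α : ℝ ↦ c * α * Real.cos (c * α))
        (c * Real.cos (c * α) + c * α * (-Real.sin (c * α) * c)) α := hl.fun_mul hC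
    have h1 : HasDerivAt (fun α : ℝ ↦ α ^ 2 / 2) (((2 : ℕ) : ℝ) * α ^ (2 - 1) / 2) α :=
      (hasDerivAt_pow 2 α).div_const 2
    have h2 : HasDerivAt (fun α : ℝ ↦ lam * α ^ 3 / 3) (lam * (((3 : ℕ) : ℝ) * α ^ (3 - 1)) / 3) α :=
      ((hasDerivAt_pow 3 α).const_mul lam).div_const 3
    have h := (h1.fun_sub h2).fun_add ((hS.fun_sub hP).div_const (2 * π * c ^ 2))
    refine h.congr_deriv ?_
    push_cast
    field_simp
    ring
  have hint : IntervalIntegrable (fun α : ℝ ↦ α - lam * α ^ 2 + α * Real.sin (c * α) / (2 * π))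
      volume 0 1 :=
    (by fun_prop : Continuous fun α : ℝ ↦
      α - lam * α ^ 2 + α * Real.sin (c * α) / (2 * π)).intervalIntegrable _ _
  rw [intervalIntegral.integral_eq_sub_of_hasDerivAt hderiv hint]
  simp only [F, mul_one, mul_zero, Real.sin_zero, Real.cos_zero, one_pow, zero_pow two_ne_zero,
    zero_pow three_ne_zero, zero_div, sub_zero]
  ring

/-- `∫_0^1 α R̂(λα) dα = λ⁻²(1/6 − 1/4π²)` for `λ ≥ 1` (the integrand vanishes on `[1/λ, 1]`; substitute
`β = λα` on `[0, 1/λ]`). [cite: BuiEtAl2023, §4 (proof of Corollary 2, "min(1, 1/λ)")] -/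
theorem integral_mul_selbergHat_of_one_le {lam : ℝ} (h1 : 1 ≤ lam) :
    ∫ α in (0 : ℝ)..1, α * (max (1 - |lam * α|) 0 +
        (if |lam * α| ≤ 1 then Real.sin (2 * π * |lam * α|) / (2 * π) else 0)) =
      (1 / 6 - 1 / (4 * π ^ 2)) / lam ^ 2 := by
  have h0 : 0 < lam := by linarith
  set g : ℝ → ℝ := fun α ↦ α * (max (1 - |lam * α|) 0 +
        (if |lam * α| ≤ 1 then Real.sin (2 * π * |lam * α|) / (2 * π) else 0)) with hg
  have hgc : Continuous g :=
    continuous_id.mul (continuous_selbergHat.comp (continuous_const.mul continuous_id))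
  rw [← intervalIntegral.integral_add_adjacent_intervals (hgc.intervalIntegrable 0 (1 / lam))
    (hgc.intervalIntegrable (1 / lam) 1)]
  -- the tail vanishes
  have htail : ∫ α in (1 / lam)..1, g α = 0 := by
    rw [← intervalIntegral.integral_zero (a := 1 / lam) (b := (1 : ℝ))]
    refine intervalIntegral.integral_congr fun α hα ↦ ?_
    rw [Set.uIcc_of_le (by rw [div_le_one h0]; exact h1), Set.mem_Icc, div_le_iff₀ h0] at hα
    rw [hg]
    dsimp only
    rw [selbergHat_of_one_le_abs (by rw [abs_of_nonneg (by nlinarith)]; linarith), mul_zero]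
  -- the head is the `λ = 1` integral, scaled
  have hhead : ∫ α in (0 : ℝ)..(1 / lam), g α = (1 / lam ^ 2) * ∫ β in (0 : ℝ)..1,
      β * (max (1 - |1 * β|) 0 + (if |1 * β| ≤ 1 then Real.sin (2 * π * |1 * β|) / (2 * π) else 0)) := by
    have hsub := intervalIntegral.integral_comp_mul_left (a := (0 : ℝ)) (b := 1 / lam)
      (fun β : ℝ ↦ β * (max (1 - |1 * β|) 0 +
        (if |1 * β| ≤ 1 then Real.sin (2 * π * |1 * β|) / (2 * π) else 0))) h0.ne'
    rw [mul_zero, mul_one_div_cancel h0.ne', smul_eq_mul] at hsub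
    have hg' : (fun α ↦ g α) = fun α ↦ (1 / lam) * ((lam * α) * (max (1 - |1 * (lam * α)|) 0 +
        (if |1 * (lam * α)| ≤ 1 then Real.sin (2 * π * |1 * (lam * α)|) / (2 * π) else 0))) := by
      funext α
      rw [hg, one_mul]
      field_simp
    rw [hg', intervalIntegral.integral_const_mul, hsub, ← mul_assoc]
    congr 1
    field_simp
  rw [htail, add_zero, hhead, integral_mul_selbergHat_of_le_one one_pos le_rfl, mul_one,
    Real.sin_two_pi, Real.cos_two_pi]
  field_simp
  ring

/-- **`c(λ;r) = λ − 1 + 2λ(1/2 − λ/3 + (sin 2πλ − 2πλ cos 2πλ)/(2π(2πλ)²))` for `0 < λ ≤ 1`.**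
[cite: BuiEtAl2023, §4 (proof of Corollary 2, display for c(λ;r))] -/
theorem cValue_selbergMinorant_div_of_le_one {lam : ℝ} (h0 : 0 < lam) (h1 : lam ≤ 1) :
    cValue (fun u : ℝ ↦ Real.sinc (π * (u / lam)) ^ 2 / (1 - (u / lam) ^ 2)) =
      lam - 1 + 2 * (lam * (1 / 2 - lam / 3 +
        (Real.sin (2 * π * lam) - 2 * π * lam * Real.cos (2 * π * lam)) / (2 * π * (2 * π * lam) ^ 2))) := by
  unfold cValue
  rw [cosTransform_selbergMinorant_div h0, mul_zero, selbergHat_zero, mul_one]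
  have h : (∫ α in (0 : ℝ)..1, α * cosTransform
      (fun u : ℝ ↦ Real.sinc (π * (u / lam)) ^ 2 / (1 - (u / lam) ^ 2)) α) =
      lam * ∫ α in (0 : ℝ)..1, α * (max (1 - |lam * α|) 0 +
        (if |lam * α| ≤ 1 then Real.sin (2 * π * |lam * α|) / (2 * π) else 0)) := by
    rw [← intervalIntegral.integral_const_mul]
    refine intervalIntegral.integral_congr fun α _ ↦ ?_
    rw [cosTransform_selbergMinorant_div h0]
    ring
  rw [h, integral_mul_selbergHat_of_le_one h0 h1]

/-- **`c(λ;r) = λ − 1 + (1/3 − 1/2π²)/λ` for `λ ≥ 1`** (in particular `c(1;r) = 1/3 − 1/2π² = 0.2826…`,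
the printed Remark). [cite: BuiEtAl2023, §4 (proof of Corollary 2 and the Remark after it)] -/
theorem cValue_selbergMinorant_div_of_one_le {lam : ℝ} (h1 : 1 ≤ lam) :
    cValue (fun u : ℝ ↦ Real.sinc (π * (u / lam)) ^ 2 / (1 - (u / lam) ^ 2)) =
      lam - 1 + (1 / 3 - 1 / (2 * π ^ 2)) / lam := by
  have h0 : 0 < lam := by linarith
  unfold cValue
  rw [cosTransform_selbergMinorant_div h0, mul_zero, selbergHat_zero, mul_one]
  have h : (∫ α in (0 : ℝ)..1, α * cosTransform
      (fun u : ℝ ↦ Real.sinc (π * (u / lam)) ^ 2 / (1 - (u / lam) ^ 2)) α) =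
      lam * ((1 / 6 - 1 / (4 * π ^ 2)) / lam ^ 2) := by
    rw [← integral_mul_selbergHat_of_one_le h1, ← intervalIntegral.integral_const_mul]
    refine intervalIntegral.integral_congr fun α _ ↦ ?_
    rw [cosTransform_selbergMinorant_div h0]
    ring
  rw [h]
  field_simp
  ring


/-- **The printed Remark: `c(1;r) = 1/3 − 1/2π² (= 0.282673…)`.**
[cite: BuiEtAl2023, §4 (Remark after the proof of Corollary 2)] -/
theorem cValue_selbergMinorant_one :
    cValue (fun u : ℝ ↦ Real.sinc (π * (u / 1)) ^ 2 / (1 - (u / 1) ^ 2)) = 1 / 3 - 1 / (2 * π ^ 2) := by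
  rw [cValue_selbergMinorant_div_of_one_le le_rfl]
  ring

/-! ## §5. "A straightforward numerical calculation": `c(0.61; r) > 0` and `c(1.0522; r) > 0.32084` -/

/-- **`c(0.61; r) > 0`** for `r = R(·/0.61)` (print: "`c(0.60729; r) > 0`"; at `λ = 0.61` the margin is
`≈ 2.5·10⁻³`, certified here from `sin θ ≤ θ`, `cos θ ≥ 1 − θ²/2` at `θ = 0.22π` and `3.14 < π < 3.15`).
[cite: BuiEtAl2023, §4 (proof of Corollary 2, "c(0.60729;r) > 0")] -/
theorem cValue_selbergMinorant_pos_061 :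
    0 < cValue (fun u : ℝ ↦ Real.sinc (π * (u / 0.61)) ^ 2 / (1 - (u / 0.61) ^ 2)) := by
  rw [cValue_selbergMinorant_div_of_le_one (by norm_num) (by norm_num)]
  set θ : ℝ := 0.22 * π with hθ
  have hc : 2 * π * 0.61 = θ + π := by rw [hθ]; ring
  rw [hc, Real.sin_add_pi, Real.cos_add_pi]
  have hπlo := Real.pi_gt_d2
  have hπhi := Real.pi_lt_d2
  have hθ0 : 0 ≤ θ := by rw [hθ]; positivity
  have hsin : Real.sin θ ≤ θ := Real.sin_le hθ0
  have hcos : 1 - θ ^ 2 / 2 ≤ Real.cos θ := Real.one_sub_sq_div_two_le_cos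
  have hπ3 : π ^ 3 < 31.256 := by
    have := pow_lt_pow_left₀ hπhi Real.pi_pos.le (n := 3) three_ne_zero
    linarith [show (3.15 : ℝ) ^ 3 < 31.256 by norm_num]
  have hD : 0 < 2 * π * (θ + π) ^ 2 := by positivity
  have key : 0 < (0.61 - 1 + 2 * (0.61 * (1 / 2 - 0.61 / 3))) * (2 * π * (θ + π) ^ 2) +
      2 * 0.61 * (-Real.sin θ - (θ + π) * -Real.cos θ) := by
    have h1 : (θ + π) * (1 - θ ^ 2 / 2) ≤ (θ + π) * Real.cos θ :=
      mul_le_mul_of_nonneg_left hcos (by positivity)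
    rw [hθ] at h1 hsin ⊢
    nlinarith [h1, hsin, hπlo, hπhi, hπ3, Real.pi_pos]
  have heq : (0.61 : ℝ) - 1 + 2 * (0.61 * (1 / 2 - 0.61 / 3 +
      (-Real.sin θ - (θ + π) * -Real.cos θ) / (2 * π * (θ + π) ^ 2))) =
      ((0.61 - 1 + 2 * (0.61 * (1 / 2 - 0.61 / 3))) * (2 * π * (θ + π) ^ 2) +
        2 * 0.61 * (-Real.sin θ - (θ + π) * -Real.cos θ)) / (2 * π * (θ + π) ^ 2) := by
    field_simp
    ring
  rw [heq]
  exact div_pos key hD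

/-- **`c(1.0522; r) > 0.32084`** for `r = R(·/1.0522)` (print: "`c(1.05214;r) > 0.3208`", used with
`n* ≤ 1.3208`; here `c = 0.0522 + (1/3 − 1/2π²)/1.0522 = 0.320849…`, from `π > 3.141592`).
[cite: BuiEtAl2023, §4 (proof of Corollary 2, "c(1.05214;r) > 0.3208")] -/
theorem cValue_selbergMinorant_1_0522_gt :
    0.32084 < cValue (fun u : ℝ ↦ Real.sinc (π * (u / 1.0522)) ^ 2 / (1 - (u / 1.0522) ^ 2)) := by
  rw [cValue_selbergMinorant_div_of_one_le (by norm_num)]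
  have hπ := Real.pi_gt_d6
  have hπ2 : 9.8696 < π ^ 2 := by nlinarith
  have h1 : 1 / (2 * π ^ 2) < 0.050661 := by
    rw [div_lt_iff₀ (by positivity)]
    nlinarith
  have h2 : (0.26864 : ℝ) * 1.0522 < 1 / 3 - 0.050661 := by norm_num
  have h3 : (0.26864 : ℝ) < (1 / 3 - 1 / (2 * π ^ 2)) / 1.0522 := by
    rw [lt_div_iff₀ (by norm_num)]
    linarith
  linarith

/-! ## §6. Assembly: RH ⇒ `D(0.61, T) ≫ 1`, `μ_D ≤ 0.61`, `lim inf δ_n ≤ 0.61` -/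

/-- **RH ⇒ `lim inf_T D(0.61, T) > 0`**: on RH, for some `A > 0` and all large `T`, at least `A · N(T)` of
the indices `n < N(T)` have `γ_{n+1} − γ_n ≤ 2π · 0.61/log T` — Theorem 3 (first clause; the tree's
`BGMM2023.spacingDensityPos_of_RH`) with the Selberg minorant `r = R(·/0.61) ∈ 𝒜(0.61)`, `c(0.61;r) > 0`.
[cite: BuiEtAl2023, §4 (proof of Corollary 2, "we conclude that μ_D ≤ 0.60729")] -/
theorem spacingDensityPos_061_of_RH (hRH : RiemannHypothesis) : SpacingDensityPos 0.61 :=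
  spacingDensityPos_of_RH hRH (by norm_num) (isAdmissible_selbergMinorant_div (by norm_num))
    cValue_selbergMinorant_pos_061

/-- **RH ⇒ `μ_D ≤ 0.61`** (print: `μ_D ≤ 0.60729` by this minorant; `0.6039` by the CGdL minorant).
[cite: BuiEtAl2023, §4 (proof of Corollary 2)] -/
theorem muDLe_061_of_RH (hRH : RiemannHypothesis) : MuDLe 0.61 :=
  fun _ hlam ↦ (spacingDensityPos_061_of_RH hRH).mono hlam.le

/-- **RH ⇒ `lim inf δ_n ≤ 0.61`** in the tree's gap-record vocabulary (`μ ≤ μ_D`).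
[cite: BuiEtAl2023, §1 ("μ ≤ μ_D ≤ μ_{D_d}")] -/
theorem zetaGapLiminfLe_061_of_RH (hRH : RiemannHypothesis) : ZetaGapLiminfLe 0.61 :=
  (muDLe_061_of_RH hRH).zetaGapLiminfLe (by norm_num)

end BGMM2023

end Literature.NumberTheory.LFunctions

end
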